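import Mathlib
import HarnessLib.Audit
import Summits.PneNP.PneNP.Theorems.ClusUniversalCertificateCubeB
import Summits.PneNP.PneNP.Theorems.ClusHilbertLemmaZ
import Summits.PneNP.PneNP.Theorems.ClusHilbertEchelon

/-!
# Route ClusUniversalCertificate — TII for every coordinate order: `Σ_y dim_Y(y) ≤ Σ_P 2·min(|P₀|,|P₁|)` (kernel proof)
(rung F-N1, cell pnp-ideate, crux `UniversalCertAll` = stmt-PneNP-19683; planner p1 g13, `HOME/pnp-ideate-p1/lines/hilbert-TII.md` §§1–3,
Theorem 7 = ROUND-12's OPEN target `TIIsum` at block size 1, with the typed statement `tii` of `lines/hilbert-TII-UNREGISTERED.lean`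
sha16 `348a487bda55c0d5` — `dimAt`, `prefClass`, `capId`, `predErr` VERBATIM; restricted-model combinatorics — nothing here bears on `P` versus `NP`)

**Theorem (`tii`).**  For every finite `Y ⊆ 𝔽₂^N`, `Σ_{y∈Y} dim_Y(y) ≤ cap_id(Y) = Σ_P 2·min(|P₀|,|P₁|)`, the sum over the internal nodes `P` of
the identity-order prefix tree of `Y` (any coordinate order by relabelling); `dim_Y(y)` = the largest dimension of an affine subspace through `y`
inside `Y`.

Proof (the planner's §§1–3 in LEVEL FORM — the Hilbert function `HF_Y` and the deficiency `Φ(Y)` of the notes are eliminated from the middle):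
* `card_rich_le_card_err` — the rich-vs-heavy count of `ClusUniversalCertificateCubeA.card_rich_le_card_heavy` for ANY rank order `r` and ANY
  triangular predictor `g`: if every point of `A` carries an `r`-increasing `θ`-flat inside `Y` then `|A| ≤ #{t ∈ Y : |φ_g(t)| ≥ θ}`.  (Indicators of
  the flats are independent — look at the `r`-minimal base point — and of degree `≤ N − θ` (`ClusCube.flatInd_lowDegree`); a dependency on the heavy
  points would be a degree-`≤ N−θ` function vanishing on `{|φ_g| ≥ θ} = {|φ_{g+1}| ≤ N−θ}`, zero by the nonlinear Lemma Z
  `ClusHilbertLemmaZ.eq_zero_of_vanish_on_sublevel`.)  This is hilbert-TII.md Lemma 2 + Theorem 3 + Lemma 5 + Corollary 6 at one level `θ`.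
* `sum_finrank_le_sum_predErr` — summing over levels: `Σ_y dim U_y ≤ Σ_{t∈Y} |φ_g(t)|` for `r`-increasing flats `U_y ⊆ Y − y` (Theorem 3 +
  Corollary 6: `Σ a_ℓ ≤ Φ ≤ Σ |φ|`).
* `ClusHilbertEchelon.lex_split` (Corollary 4) — an ECHELON argument: every subspace `W` is spanned by pivot vectors with distinct leading
  coordinates; those leading at a `0` of `y` span a LEX-INCREASING subspace `U₁` (every non-zero `u` has `y + u >_lex y`), those leading at a
  `1` of `y` a LEX-DECREASING `U₂`, and `dim W ≤ dim U₁ + dim U₂`.  Lex ranks: `Pi.Lex` on `Fin N → ℕ` through `ZMod.val`.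
* `two_mul_sum_predErr_maj` (Theorem 7's count) — for the MAJORITY predictor `Σ_{t∈Y} |φ(t)| = Σ_P min(|P₀|,|P₁|) = cap_id(Y)/2`.
* `tii` — `Σ dim_Y = Σ dim W_y ≤ Σ dim U₁ + Σ dim U₂ ≤ 2·Σ_t |φ_maj(t)| = cap_id(Y)`.
-/

set_option linter.dupNamespace false -- `Summit.PneNP.PneNP.…`: summit = sub-problem name (D-0017 single-conjunct layout)

namespace Summit.PneNP.PneNP.Theorems.ClusHilbert

open Finset MvPolynomial
open Summit.PneNP.PneNP.Theorems.ClusCube (V flatInd flatInd_lowDegree exists_submodule_finrank_eq sum_eq_sum_card_lt)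

variable {N : ℕ}

/-- Every element of `ZMod 2` is `0` or `1`. -/
private theorem zmod2_eq_zero_or_one (z : ZMod 2) : z = 0 ∨ z = 1 := by
  fin_cases z
  · exact Or.inl rfl
  · exact Or.inr rfl

/-! ## Rich points versus heavy points, for any order and any predictor -/

/-- **Level form of the Hilbert bound.**  If every point of `A` carries an `r`-increasing `θ`-dimensional flat inside `Y` (every non-zero `v` of the
flat direction has `r a < r (a + v)`), then `|A| ≤ #{t ∈ Y : |φ_g(t)| ≥ θ}` for every triangular predictor `g`. -/
theorem card_rich_le_card_err {β : Type*} [LinearOrder β] (r : V N → β) (g : (t : Fin N) → (Fin t → ZMod 2) → ZMod 2)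
    (Y A : Finset (V N)) (θ : ℕ) (Va : V N → Submodule (ZMod 2) (V N))
    (hinc : ∀ a ∈ A, ∀ v ∈ Va a, v ≠ 0 → r a < r (a + v))
    (hdim : ∀ a ∈ A, Module.finrank (ZMod 2) (Va a) = θ)
    (hY : ∀ a ∈ A, ∀ v ∈ Va a, a + v ∈ Y) :
    A.card ≤ (Y.filter fun t => θ ≤ predErr g t).card := by
  classical
  rcases A.eq_empty_or_nonempty with hA | ⟨a₁, ha₁⟩
  · simp [hA]
  have hθN : θ ≤ N := by
    rw [← hdim a₁ ha₁]
    exact (Submodule.finrank_le (Va a₁)).trans (by simp)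
  set H := Y.filter fun t => θ ≤ predErr g t with hH
  let row : A → (H → ZMod 2) := fun a t => flatInd (a : V N) (Va a) t
  have hli : LinearIndependent (ZMod 2) row := by
    rw [linearIndependent_iff']
    intro s c hsum a ha
    by_contra hca
    let F : V N → ZMod 2 := fun x => ∑ a ∈ s, c a * flatInd (a : V N) (Va a) x
    -- `F` vanishes on all heavy points
    have hF0 : ∀ x : V N, θ ≤ predErr g x → F x = 0 := by
      intro x hx
      by_cases hxY : x ∈ Y
      · have hxH : x ∈ H := by rw [hH]; exact mem_filter.mpr ⟨hxY, hx⟩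
        have := congrFun hsum ⟨x, hxH⟩
        simpa [row, Finset.sum_apply, Pi.smul_apply, smul_eq_mul] using this
      · refine sum_eq_zero fun a _ => ?_
        have : flatInd (a : V N) (Va a) x = 0 := by
          unfold flatInd
          rw [if_neg]
          intro hmem
          have := hY a a.2 _ hmem
          rw [add_sub_cancel] at this
          exact hxY this
        rw [this, mul_zero]
    -- `F` is a function of degree `≤ N - θ`
    have hmem : F ∈ Pdeg (univ : Finset (Fin N)) (N - θ) := by
      choose P hP using fun a : A => flatInd_lowDegree (a : V N) (Va a)
      have hF : F = ∑ a ∈ s, c a • (fun x : V N => eval x (P a)) := by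
        funext x
        simp only [F, Finset.sum_apply, Pi.smul_apply, smul_eq_mul]
        exact Finset.sum_congr rfl fun a _ => by rw [(hP a).2]
      rw [hF]
      refine Submodule.sum_mem _ fun a _ => Submodule.smul_mem _ _ (eval_mem_Pdeg (P a) ?_)
      have h1 := (hP a).1
      rw [hdim a a.2] at h1
      omega
    -- hence zero, by the nonlinear Lemma Z for the complementary predictor
    have hFzero : F = 0 := by
      refine eq_zero_of_vanish_on_sublevel (flipPred g) (N - θ) F hmem fun x hx => hF0 x ?_
      have := predErr_add_predErr_flip g x
      omega
    -- an `r`-minimal base point with non-zero coefficient is covered once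
    set S' := s.filter fun a => c a ≠ 0 with hS'
    have hne : S'.Nonempty := ⟨a, by rw [hS']; exact mem_filter.mpr ⟨ha, hca⟩⟩
    obtain ⟨a₀, ha₀, hmin⟩ := S'.exists_min_image (fun a => r (a : V N)) hne
    have ha₀s : a₀ ∈ s := (mem_filter.mp ha₀).1
    have hca₀ : c a₀ ≠ 0 := (mem_filter.mp ha₀).2
    have hFa₀ : F a₀ = c a₀ := by
      simp only [F]
      rw [sum_eq_single_of_mem a₀ ha₀s]
      · unfold flatInd
        rw [sub_self, if_pos (Submodule.zero_mem _), mul_one]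
      · intro a has hne'
        by_cases hc : c a = 0
        · rw [hc, zero_mul]
        · have haS' : a ∈ S' := by rw [hS']; exact mem_filter.mpr ⟨has, hc⟩
          unfold flatInd
          rw [if_neg, mul_zero]
          intro hv
          have hne0 : (a₀ : V N) - (a : V N) ≠ 0 := fun h => hne' (Subtype.ext (sub_eq_zero.mp h)).symm
          have hlt := hinc a a.2 _ hv hne0
          rw [add_sub_cancel] at hlt
          exact absurd (hmin a haS') (not_le.mpr hlt)
    exact hca₀ (hFa₀ ▸ congrFun hFzero a₀)
  have := hli.fintype_card_le_finrank
  rw [Module.finrank_pi, Fintype.card_coe, Fintype.card_coe] at this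
  exact this

/-- **Theorem 3 + Corollary 6 of the notes, combined (`Φ` eliminated).**  If every `y ∈ Y` carries an `r`-increasing flat `y + U_y ⊆ Y` then
`Σ_y dim U_y ≤ Σ_{t ∈ Y} |φ_g(t)|` for every triangular predictor `g`. -/
theorem sum_finrank_le_sum_predErr {β : Type*} [LinearOrder β] (r : V N → β) (g : (t : Fin N) → (Fin t → ZMod 2) → ZMod 2)
    (Y : Finset (V N)) (U : V N → Submodule (ZMod 2) (V N))
    (hinc : ∀ y ∈ Y, ∀ v ∈ U y, v ≠ 0 → r y < r (y + v)) (hY : ∀ y ∈ Y, ∀ v ∈ U y, y + v ∈ Y) :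
    ∑ y ∈ Y, Module.finrank (ZMod 2) (U y) ≤ ∑ t ∈ Y, predErr g t := by
  classical
  have hdom : ∀ θ, (Y.filter fun y => θ < Module.finrank (ZMod 2) (U y)).card ≤ (Y.filter fun t => θ < predErr g t).card := by
    intro θ
    set A := Y.filter fun y => θ < Module.finrank (ZMod 2) (U y) with hA
    have hex : ∀ a : V N, ∃ U' : Submodule (ZMod 2) (V N), a ∈ A → (U' ≤ U a ∧ Module.finrank (ZMod 2) U' = θ + 1) := by
      intro a
      by_cases ha : a ∈ A
      · obtain ⟨U', h1, h2⟩ := exists_submodule_finrank_eq (U a) (θ + 1) (mem_filter.mp ha).2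
        exact ⟨U', fun _ => ⟨h1, h2⟩⟩
      · exact ⟨⊥, fun h => absurd h ha⟩
    choose Va hVa using hex
    have key := card_rich_le_card_err r g Y A (θ + 1) Va ?_ ?_ ?_
    · have heq : (Y.filter fun t => θ + 1 ≤ predErr g t) = Y.filter fun t => θ < predErr g t := by
        ext t; simp only [mem_filter, Nat.succ_le_iff]
      rw [heq] at key
      exact key
    · intro a ha v hv hv0
      exact hinc a (mem_filter.mp ha).1 v ((hVa a ha).1 hv) hv0
    · intro a ha
      exact (hVa a ha).2
    · intro a ha v hv
      exact hY a (mem_filter.mp ha).1 v ((hVa a ha).1 hv)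
  rw [sum_eq_sum_card_lt Y (fun y => Module.finrank (ZMod 2) (U y)) (fun y _ => (Submodule.finrank_le _).trans (by simp)),
    sum_eq_sum_card_lt Y (predErr g) (fun y _ => predErr_le g y)]
  exact sum_le_sum fun θ _ => hdom θ

/-! ## The objects of the statement (p1's definitions, verbatim) -/

/-- `dim_Y(y)`: the largest dimension of an affine subspace through `y` contained in `Y` -/
noncomputable def dimAt (Y : Finset (V N)) (y : V N) : ℕ :=
  sSup {k : ℕ | ∃ A : AffineSubspace (ZMod 2) (V N),
    y ∈ A ∧ (∀ z ∈ A, z ∈ Y) ∧ Module.finrank (ZMod 2) A.direction = k}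

/-- the class of `Y` below the prefix `u : Fin t → ZMod 2` extended by the bit `b` at coordinate `t` -/
def prefClass (Y : Finset (V N)) (t : Fin N) (u : Fin t → ZMod 2) (b : ZMod 2) : Finset (V N) :=
  Y.filter fun y => (∀ i : Fin t, y (Fin.castLT i (lt_trans i.isLt t.isLt)) = u i) ∧ y t = b

/-- `cap_id(Y) = Σ_P 2·min(|P₀|,|P₁|)` over the internal nodes `P` of the identity-order prefix tree (g12's `tiiCap` at block size 1) -/
def capId (Y : Finset (V N)) : ℕ :=
  ∑ t : Fin N, ∑ u : (Fin t → ZMod 2),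
    2 * min (prefClass Y t u 0).card (prefClass Y t u 1).card

/-- Every point of `Y` carries a flat direction inside `Y` of dimension `dim_Y(y)` (the `sSup` is attained). -/
theorem exists_direction (Y : Finset (V N)) {y : V N} (hy : y ∈ Y) :
    ∃ W : Submodule (ZMod 2) (V N), (∀ w ∈ W, y + w ∈ Y) ∧ Module.finrank (ZMod 2) W = dimAt Y y := by
  set S := {k : ℕ | ∃ A : AffineSubspace (ZMod 2) (V N),
    y ∈ A ∧ (∀ z ∈ A, z ∈ Y) ∧ Module.finrank (ZMod 2) A.direction = k} with hS
  have hne : S.Nonempty := by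
    refine ⟨0, AffineSubspace.mk' y ⊥, AffineSubspace.self_mem_mk' _ _, fun z hz => ?_, by
      rw [AffineSubspace.direction_mk']; simp⟩
    rw [AffineSubspace.mem_mk'] at hz
    have : z = y := by
      rw [Submodule.mem_bot, vsub_eq_sub, sub_eq_zero] at hz
      exact hz
    rw [this]; exact hy
  have hbdd : BddAbove S := by
    refine ⟨N, fun k hk => ?_⟩
    obtain ⟨A, -, -, hk⟩ := hk
    rw [← hk]
    exact (Submodule.finrank_le _).trans (by simp)
  obtain ⟨A, hyA, hAY, hk⟩ := Nat.sSup_mem hne hbdd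
  refine ⟨A.direction, fun w hw => hAY _ ?_, hk⟩
  have := AffineSubspace.vadd_mem_of_mem_direction hw hyA
  rw [vadd_eq_add, add_comm] at this
  exact this

/-! ## The majority predictor -/

/-- the majority predictor of `Y`: at the class of the prefix `u`, predict the more frequent next bit (ties to `0`) -/
def maj (Y : Finset (V N)) : (t : Fin N) → (Fin t → ZMod 2) → ZMod 2 := fun t u =>
  if (prefClass Y t u 1).card ≤ (prefClass Y t u 0).card then 0 else 1

/-- **Theorem 7's count.**  The majority predictor errs exactly on the minority classes: `2·Σ_{t∈Y} |φ_maj(t)| = cap_id(Y)`. -/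
theorem two_mul_sum_predErr_maj (Y : Finset (V N)) : 2 * ∑ y ∈ Y, predErr (maj Y) y = capId Y := by
  classical
  -- errors counted coordinate by coordinate
  have h1 : ∑ y ∈ Y, predErr (maj Y) y = ∑ t : Fin N, (Y.filter fun y => y t ≠ maj Y t (pre y t)).card := by
    unfold predErr pre
    simp_rw [card_filter]
    rw [sum_comm]
  -- at coordinate `t`, class by class: the majority predictor errs on the minority
  have h2 : ∀ t : Fin N, (Y.filter fun y => y t ≠ maj Y t (pre y t)).card =
      ∑ u : Fin t → ZMod 2, min (prefClass Y t u 0).card (prefClass Y t u 1).card := by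
    intro t
    rw [card_eq_sum_card_fiberwise (f := fun y => pre y t) (t := (univ : Finset (Fin t → ZMod 2)))
      (fun y _ => Finset.mem_coe.2 (mem_univ _))]
    refine sum_congr rfl fun u _ => ?_
    by_cases hle : (prefClass Y t u 1).card ≤ (prefClass Y t u 0).card
    · have hmaj : maj Y t u = 0 := by simp only [maj]; rw [if_pos hle]
      rw [min_eq_right hle]
      congr 1
      ext y
      simp only [mem_filter, prefClass]
      constructor
      · rintro ⟨⟨hy, herr⟩, hpre⟩
        refine ⟨hy, fun i => ?_, ?_⟩
        · exact congrFun hpre i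
        · rw [hpre, hmaj] at herr
          exact (zmod2_eq_zero_or_one _).resolve_left herr
      · rintro ⟨hy, hpre, hyt⟩
        have hpre' : pre y t = u := funext hpre
        refine ⟨⟨hy, ?_⟩, hpre'⟩
        rw [hpre', hmaj, hyt]
        exact one_ne_zero
    · have hmaj : maj Y t u = 1 := by simp only [maj]; rw [if_neg hle]
      rw [min_eq_left (le_of_lt (not_le.mp hle))]
      congr 1
      ext y
      simp only [mem_filter, prefClass]
      constructor
      · rintro ⟨⟨hy, herr⟩, hpre⟩
        refine ⟨hy, fun i => ?_, ?_⟩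
        · exact congrFun hpre i
        · rw [hpre, hmaj] at herr
          exact (zmod2_eq_zero_or_one _).resolve_right herr
      · rintro ⟨hy, hpre, hyt⟩
        have hpre' : pre y t = u := funext hpre
        refine ⟨⟨hy, ?_⟩, hpre'⟩
        rw [hpre', hmaj, hyt]
        exact zero_ne_one
  unfold capId
  rw [h1, mul_sum]
  refine sum_congr rfl fun t _ => ?_
  rw [h2 t, mul_sum]

/-! ## TII -/

/-- **Theorem 7 (TII, identity order; any coordinate order by relabelling).**  `Σ_{y∈Y} dim_Y(y) ≤ cap_id(Y) = Σ_P 2·min(|P₀|,|P₁|)`. -/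
theorem tii (Y : Finset (V N)) : ∑ y ∈ Y, dimAt Y y ≤ capId Y := by
  classical
  -- a flat direction of dimension `dim_Y(y)` at every point
  have hex : ∀ y : V N, ∃ W : Submodule (ZMod 2) (V N),
      y ∈ Y → ((∀ w ∈ W, y + w ∈ Y) ∧ Module.finrank (ZMod 2) W = dimAt Y y) := by
    intro y
    by_cases hy : y ∈ Y
    · obtain ⟨W, h1, h2⟩ := exists_direction Y hy
      exact ⟨W, fun _ => ⟨h1, h2⟩⟩
    · exact ⟨⊥, fun h => absurd h hy⟩
  choose W hW using hex
  -- its lex split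
  have hsp : ∀ y : V N, ∃ U : Submodule (ZMod 2) (V N) × Submodule (ZMod 2) (V N),
      U.1 ≤ W y ∧ U.2 ≤ W y ∧
      Module.finrank (ZMod 2) (W y) ≤ Module.finrank (ZMod 2) U.1 + Module.finrank (ZMod 2) U.2 ∧
      (∀ u ∈ U.1, u ≠ 0 → ∃ t, (∀ i, i < t → u i = 0) ∧ u t ≠ 0 ∧ y t = 0) ∧
      (∀ u ∈ U.2, u ≠ 0 → ∃ t, (∀ i, i < t → u i = 0) ∧ u t ≠ 0 ∧ y t ≠ 0) := by
    intro y
    obtain ⟨U₁, U₂, h⟩ := lex_split y (W y)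
    exact ⟨(U₁, U₂), h⟩
  choose U hU using hsp
  -- the increasing parts, against the lex order
  have hup : ∑ y ∈ Y, Module.finrank (ZMod 2) (U y).1 ≤ ∑ t ∈ Y, predErr (maj Y) t := by
    refine sum_finrank_le_sum_predErr lexRank (maj Y) Y (fun y => (U y).1) (fun y _ v hv hv0 => ?_)
      (fun y hy v hv => (hW y hy).1 v ((hU y).1 hv))
    obtain ⟨t, hz, hvt, hyt⟩ := (hU y).2.2.2.1 v hv hv0
    exact lexRank_lt_of_lead_zero hz hvt hyt
  -- the decreasing parts, against the reverse lex order
  have hdown : ∑ y ∈ Y, Module.finrank (ZMod 2) (U y).2 ≤ ∑ t ∈ Y, predErr (maj Y) t := by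
    refine sum_finrank_le_sum_predErr (fun y => OrderDual.toDual (lexRank y)) (maj Y) Y (fun y => (U y).2)
      (fun y _ v hv hv0 => ?_) (fun y hy v hv => (hW y hy).1 v ((hU y).2.1 hv))
    obtain ⟨t, hz, hvt, hyt⟩ := (hU y).2.2.2.2 v hv hv0
    exact OrderDual.toDual_lt_toDual.mpr (lexRank_add_lt_of_lead_one hz hvt hyt)
  calc ∑ y ∈ Y, dimAt Y y = ∑ y ∈ Y, Module.finrank (ZMod 2) (W y) := sum_congr rfl fun y hy => (hW y hy).2.symm
    _ ≤ ∑ y ∈ Y, (Module.finrank (ZMod 2) (U y).1 + Module.finrank (ZMod 2) (U y).2) := sum_le_sum fun y _ => (hU y).2.2.1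
    _ = ∑ y ∈ Y, Module.finrank (ZMod 2) (U y).1 + ∑ y ∈ Y, Module.finrank (ZMod 2) (U y).2 := sum_add_distrib
    _ ≤ ∑ t ∈ Y, predErr (maj Y) t + ∑ t ∈ Y, predErr (maj Y) t := add_le_add hup hdown
    _ = 2 * ∑ t ∈ Y, predErr (maj Y) t := by ring
    _ = capId Y := two_mul_sum_predErr_maj Y

end Summit.PneNP.PneNP.Theorems.ClusHilbert
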